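import Summits.HubbardSuperconductivity.HubbardSuperconductivity.Theorems.AnisotropyChordTransferFibre3BetaFreeTargets
import Summits.HubbardSuperconductivity.HubbardSuperconductivity.Theorems.AnisotropyChordTransferFibre3PoleGap
import Summits.HubbardSuperconductivity.HubbardSuperconductivity.Theorems.AnisotropyChordTransferFibre3KreinJF

/-!
# Route `AnisotropyChord` / H0 rotor rung: the `G`-form in Fourier space and the LOW/REST SPLIT (memo 20 §288(a), memo 21 §301 STEP 3)

For the pole-removed free resolvent of the `K₁` fibre (`…TransferFibre3Resolvent`):
* `re_Gform_self_eq`: `Re⟨R, G_T R⟩ = V⁻² Σ_{k ∉ pole} |R̂(k)|²/den_T(k)` (Parseval; `R̂ = cfgDFT R = fcoef R`);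
* `sum_split_pole_low_rest`: any `k`-sum splits into poles + the low set (`lowSet`, the 45 points of `IsLowShell`) + the rest;
* **`re_Gform_le_split`**: if `m ≤ den_T(k)` on the rest (non-pole, non-low) with `m > 0`, then
  `Re⟨R,G_T R⟩ ≤ Σ_{low} |R̂|²/(V²den) + (‖R‖² − Σ_j|⟨p_j,R⟩|²/V² − Σ_{low}|R̂|²/V²)/m`
  — the split of memo 21 §296(a)/§301 STEP 3 with the pole part `P` and the low part subtracted exactly
  (`polePart`, `lowNormPart`, `lowGForm` of `…Fibre3BetaFreeTargets` are the case `R = R′`, `T = T⁺`).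
Prover seat `hubbard-h0-rotor-p1` g22; helper for stmt-HubbardSuperconductivity-19089 (`--supports`).
-/

set_option linter.dupNamespace false
set_option autoImplicit false

noncomputable section

open scoped BigOperators
open Complex

namespace Summit.HubbardSuperconductivity.HubbardSuperconductivity.Theorems.AnisotropyChord.Transfer.Fibre3

variable (L : ℕ) [NeZero L]

/-! ## The `G`-form in Fourier space -/

omit [NeZero L] in
/-- the configuration-space DFT is the plane-wave coefficient. [folklore] -/
theorem cfgDFT_eq_fcoef [NeZero L] (R : Cfg L → ℂ) (k : Tor L × Tor L) : cfgDFT L R k.1 k.2 = fcoef L R k := rfl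

/-- `Complex.normSq z = ‖z‖²`. [folklore] -/
theorem normSq_eq_norm_sq' (z : ℂ) : Complex.normSq z = ‖z‖ ^ 2 := Complex.normSq_eq_norm_sq z

/-- **`Re⟨R, G_T R⟩ = V⁻² Σ_k w¹_k |R̂_k|²`**, `w¹_k = [k ∉ pole]/den_T(k)`. [folklore] -/
theorem re_Gform_self_eq (T : ℝ) (R : Cfg L → ℂ) :
    (Gform L T R R).re = (1 / ((L : ℝ) ^ 2) ^ 2) * ∑ k : Tor L × Tor L, w1 L T k * ‖fcoef L R k‖ ^ 2 := by
  rw [Gform_eq_ip]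
  have hG : ∀ c, Gapply L T R c = (1 / ((L : ℂ) ^ 2) ^ 2) * ∑ k : Tor L × Tor L, gcoef L T R k * pw L k.1 k.2 c :=
    fun c => Gapply_eq L T R c
  have e1 : ip L R (Gapply L T R)
      = (1 / ((L : ℂ) ^ 2) ^ 2) * ∑ k : Tor L × Tor L, gcoef L T R k * (starRingEnd ℂ) (fcoef L R k) := by
    unfold ip
    simp_rw [hG]
    calc ∑ c : Cfg L, (starRingEnd ℂ) (R c) * ((1 / ((L : ℂ) ^ 2) ^ 2) * ∑ k : Tor L × Tor L, gcoef L T R k * pw L k.1 k.2 c)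
        = ∑ c : Cfg L, ∑ k : Tor L × Tor L, (1 / ((L : ℂ) ^ 2) ^ 2) * (gcoef L T R k * ((starRingEnd ℂ) (R c) * pw L k.1 k.2 c)) := by
          refine Finset.sum_congr rfl fun c _ => ?_
          rw [Finset.mul_sum, Finset.mul_sum]
          refine Finset.sum_congr rfl fun k _ => ?_; ring
      _ = ∑ k : Tor L × Tor L, ∑ c : Cfg L, (1 / ((L : ℂ) ^ 2) ^ 2) * (gcoef L T R k * ((starRingEnd ℂ) (R c) * pw L k.1 k.2 c)) :=
          Finset.sum_comm
      _ = (1 / ((L : ℂ) ^ 2) ^ 2) * ∑ k : Tor L × Tor L, gcoef L T R k * (starRingEnd ℂ) (fcoef L R k) := by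
          rw [Finset.mul_sum]
          refine Finset.sum_congr rfl fun k _ => ?_
          rw [← Finset.mul_sum, ← Finset.mul_sum]
          congr 2
          rw [← ip_Y_pw]; rfl
  rw [e1]
  have hV : (1 / ((L : ℂ) ^ 2) ^ 2) = (((1 / ((L : ℝ) ^ 2) ^ 2 : ℝ)) : ℂ) := by push_cast; ring
  rw [hV, Complex.re_ofReal_mul, Complex.re_sum]
  congr 1
  refine Finset.sum_congr rfl fun k _ => ?_
  unfold gcoef w1
  split_ifs with hk
  · simp
  · rw [show ip L (pw L k.1 k.2) R = fcoef L R k from rfl, div_mul_eq_mul_div, mul_comm, Complex.conj_mul',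
      show ((‖fcoef L R k‖ : ℂ) ^ 2 / (den L T k.1 k.2 : ℂ)) = (((‖fcoef L R k‖ ^ 2 / den L T k.1 k.2 : ℝ)) : ℂ) by
        push_cast; ring, Complex.ofReal_re]
    ring

/-- **Parseval:** `Re⟨R, R⟩ = V⁻² Σ_k |R̂_k|²`. [folklore] -/
theorem re_ip_self_fourier (R : Cfg L → ℂ) :
    (ip L R R).re = (1 / ((L : ℝ) ^ 2) ^ 2) * ∑ k : Tor L × Tor L, ‖fcoef L R k‖ ^ 2 := by
  rw [ip_self_fourier]
  have hV : (1 / ((L : ℂ) ^ 2) ^ 2) = (((1 / ((L : ℝ) ^ 2) ^ 2 : ℝ)) : ℂ) := by push_cast; ring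
  rw [hV, Complex.re_ofReal_mul, Complex.re_sum]
  congr 1
  refine Finset.sum_congr rfl fun k _ => ?_
  rw [Complex.conj_mul', show ((‖fcoef L R k‖ : ℂ) ^ 2) = (((‖fcoef L R k‖ ^ 2 : ℝ)) : ℂ) by push_cast; ring,
    Complex.ofReal_re]

/-! ## Splitting a momentum sum into poles, the low set, and the rest -/

open Classical in
/-- the complement of poles and low set. [folklore] -/
def restSet : Finset (Tor L × Tor L) :=
  Finset.univ.filter (fun k => IsPoleK1 L k.1 k.2 = false ∧ ¬ IsLowShell L k.1 k.2)

open Classical in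
/-- **poles + low + rest:** `Σ_k φ(k) = Σ_k [pole]φ + Σ_{low} φ + Σ_{rest} φ`. [folklore] -/
theorem sum_split_pole_low_rest (φ : Tor L × Tor L → ℝ) :
    ∑ k : Tor L × Tor L, φ k
      = (∑ k : Tor L × Tor L, if IsPoleK1 L k.1 k.2 then φ k else 0) + ∑ k ∈ lowSet L, φ k + ∑ k ∈ restSet L, φ k := by
  rw [← Finset.sum_filter]
  have h1 := Finset.sum_filter_add_sum_filter_not Finset.univ (fun k : Tor L × Tor L => IsPoleK1 L k.1 k.2 = true) φ
  have h2 := Finset.sum_filter_add_sum_filter_not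
    (Finset.univ.filter fun k : Tor L × Tor L => ¬ (IsPoleK1 L k.1 k.2 = true)) (fun k => IsLowShell L k.1 k.2) φ
  rw [Finset.filter_filter, Finset.filter_filter] at h2
  have hlow : Finset.univ.filter (fun k : Tor L × Tor L => ¬ (IsPoleK1 L k.1 k.2 = true) ∧ IsLowShell L k.1 k.2)
      = lowSet L := by
    unfold lowSet
    refine Finset.filter_congr fun k _ => ?_
    constructor
    · exact fun h => h.2
    · intro h; exact ⟨by rw [h.1]; simp, h⟩
  have hrest : Finset.univ.filter (fun k : Tor L × Tor L => ¬ (IsPoleK1 L k.1 k.2 = true) ∧ ¬ IsLowShell L k.1 k.2)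
      = restSet L := by
    unfold restSet
    refine Finset.filter_congr fun k _ => ?_
    simp
  rw [hlow, hrest] at h2
  linarith

/-- the pole part of `Σ_k |R̂_k|²` is `Σ_j |⟨p_j, R⟩|²` (`L ≥ 2`). [folklore] -/
theorem sum_pole_normSq (hL : 2 ≤ L) (R : Cfg L → ℂ) :
    (∑ k : Tor L × Tor L, if IsPoleK1 L k.1 k.2 then ‖fcoef L R k‖ ^ 2 else 0)
      = ∑ j : Fin 3, Complex.normSq (ip L (poleWave L j) R) := by
  have h0 : poleWave L 0 = pw L 0 0 := funext fun c => (poleWave_eq L c).1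
  have h1 : poleWave L 1 = pw L (K1 L) 0 := funext fun c => (poleWave_eq L c).2.1
  have h2 : poleWave L 2 = pw L 0 (K1 L) := funext fun c => (poleWave_eq L c).2.2
  have key := sum_pole L hL (fun k => (((‖fcoef L R k‖ ^ 2 : ℝ)) : ℂ))
  have e : (∑ k : Tor L × Tor L, if IsPoleK1 L k.1 k.2 then (((‖fcoef L R k‖ ^ 2 : ℝ)) : ℂ) else 0)
      = (((∑ k : Tor L × Tor L, if IsPoleK1 L k.1 k.2 then ‖fcoef L R k‖ ^ 2 else 0 : ℝ)) : ℂ) := by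
    push_cast
    refine Finset.sum_congr rfl fun k _ => ?_
    split_ifs <;> simp
  rw [e] at key
  have key' := congrArg Complex.re key
  rw [Complex.ofReal_re] at key'
  rw [key', Fin.sum_univ_three, h0, h1, h2]
  simp only [Complex.add_re, Complex.ofReal_re, normSq_eq_norm_sq']
  rfl

/-! ## The split bound -/

/-- **THE LOW/REST SPLIT** (memo 20 §288(a), memo 21 §301 STEP 3): if `m ≤ den_T(k)` for every non-pole `k` off the low set,
`m > 0`, `L ≥ 4`, then
`Re⟨R, G_T R⟩ ≤ Σ_{low}|R̂|²/(V² den) + (Re⟨R,R⟩ − Σ_j|⟨p_j,R⟩|²/V² − Σ_{low}|R̂|²/V²)/m`. [folklore] -/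
theorem re_Gform_le_split (hL : 4 ≤ L) (T : ℝ) (R : Cfg L → ℂ) {m : ℝ} (hm : 0 < m)
    (hden : ∀ k₂ k₃ : Tor L, IsPoleK1 L k₂ k₃ = false → ¬ IsLowShell L k₂ k₃ → m ≤ den L T k₂ k₃) :
    (Gform L T R R).re
      ≤ (∑ k ∈ lowSet L, Complex.normSq (cfgDFT L R k.1 k.2) / (((L : ℝ) ^ 2) ^ 2 * den L T k.1 k.2))
        + ((ip L R R).re - (∑ j : Fin 3, Complex.normSq (ip L (poleWave L j) R) / ((L : ℝ) ^ 2) ^ 2)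
            - ∑ k ∈ lowSet L, Complex.normSq (cfgDFT L R k.1 k.2) / ((L : ℝ) ^ 2) ^ 2) / m := by
  classical
  have hL2 : 2 ≤ L := by omega
  set V2 : ℝ := ((L : ℝ) ^ 2) ^ 2 with hV2
  have hV2pos : 0 < V2 := by
    have : (0 : ℝ) < L := by exact_mod_cast Nat.pos_of_ne_zero (NeZero.ne L)
    positivity
  -- Fourier forms
  rw [re_Gform_self_eq, re_ip_self_fourier]
  rw [sum_split_pole_low_rest L (fun k => w1 L T k * ‖fcoef L R k‖ ^ 2),
    sum_split_pole_low_rest L (fun k => ‖fcoef L R k‖ ^ 2), sum_pole_normSq L hL2 R]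
  -- the pole terms of the G-form vanish
  have hpole0 : (∑ k : Tor L × Tor L, if IsPoleK1 L k.1 k.2 then w1 L T k * ‖fcoef L R k‖ ^ 2 else 0) = 0 := by
    refine Finset.sum_eq_zero fun k _ => ?_
    split_ifs with hk
    · unfold w1; rw [if_pos hk]; ring
    · rfl
  -- on the low set: w1 = 1/den
  have hlow : ∑ k ∈ lowSet L, w1 L T k * ‖fcoef L R k‖ ^ 2
      = ∑ k ∈ lowSet L, ‖fcoef L R k‖ ^ 2 / den L T k.1 k.2 := by
    refine Finset.sum_congr rfl fun k hk => ?_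
    unfold lowSet at hk
    rw [Finset.mem_filter] at hk
    unfold w1; rw [hk.2.1]; simp only [Bool.false_eq_true, if_false]; ring
  -- on the rest: w1 ≤ 1/m
  have hrest : ∑ k ∈ restSet L, w1 L T k * ‖fcoef L R k‖ ^ 2 ≤ (∑ k ∈ restSet L, ‖fcoef L R k‖ ^ 2) / m := by
    rw [Finset.sum_div]
    apply Finset.sum_le_sum
    intro k hk
    unfold restSet at hk
    rw [Finset.mem_filter] at hk
    obtain ⟨_, hkp, hkl⟩ := hk
    have hdk := hden k.1 k.2 hkp hkl
    unfold w1; rw [hkp]; simp only [Bool.false_eq_true, if_false]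
    rw [one_div_mul_eq_div]
    exact div_le_div_of_nonneg_left (sq_nonneg _) hm hdk
  rw [hpole0, zero_add, hlow]
  -- bookkeeping of the `V²` factors
  have e1 : (∑ k ∈ lowSet L, Complex.normSq (cfgDFT L R k.1 k.2) / (V2 * den L T k.1 k.2))
      = (1 / V2) * ∑ k ∈ lowSet L, ‖fcoef L R k‖ ^ 2 / den L T k.1 k.2 := by
    rw [Finset.mul_sum]
    refine Finset.sum_congr rfl fun k _ => ?_
    rw [cfgDFT_eq_fcoef, normSq_eq_norm_sq']
    field_simp
  have e2 : (∑ k ∈ lowSet L, Complex.normSq (cfgDFT L R k.1 k.2) / V2)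
      = (1 / V2) * ∑ k ∈ lowSet L, ‖fcoef L R k‖ ^ 2 := by
    rw [Finset.mul_sum]
    refine Finset.sum_congr rfl fun k _ => ?_
    rw [cfgDFT_eq_fcoef, normSq_eq_norm_sq']
    field_simp
  have e3 : (∑ j : Fin 3, Complex.normSq (ip L (poleWave L j) R) / V2)
      = (1 / V2) * ∑ j : Fin 3, Complex.normSq (ip L (poleWave L j) R) := by
    rw [Finset.mul_sum]
    refine Finset.sum_congr rfl fun j _ => ?_
    field_simp
  rw [e1, e2, e3]
  have e4 : (1 / V2) * ((∑ j : Fin 3, Complex.normSq (ip L (poleWave L j) R)) + ∑ k ∈ lowSet L, ‖fcoef L R k‖ ^ 2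
        + ∑ k ∈ restSet L, ‖fcoef L R k‖ ^ 2)
      - (1 / V2) * ∑ j : Fin 3, Complex.normSq (ip L (poleWave L j) R)
      - (1 / V2) * ∑ k ∈ lowSet L, ‖fcoef L R k‖ ^ 2
      = (1 / V2) * ∑ k ∈ restSet L, ‖fcoef L R k‖ ^ 2 := by ring
  rw [e4, mul_add]
  have h5 : (1 / V2) * ∑ k ∈ restSet L, w1 L T k * ‖fcoef L R k‖ ^ 2
      ≤ (1 / V2) * ((∑ k ∈ restSet L, ‖fcoef L R k‖ ^ 2) / m) :=
    mul_le_mul_of_nonneg_left hrest (by positivity)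
  rw [← mul_div_assoc] at h5
  linarith [h5]

end Summit.HubbardSuperconductivity.HubbardSuperconductivity.Theorems.AnisotropyChord.Transfer.Fibre3

end
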